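import Summits.QuantumFields.YangMills.Theorems.SmallCircleAnchorAnchorGapGaussianCovHeat
import Summits.QuantumFields.YangMills.Theorems.SmallCircleAnchorAnchorGapCovFullPtPosDef
import Summits.QuantumFields.YangMills.Theorems.SmallCircleAnchorAnchorGapPolyGrowthClass

/-!
# Crux `AnchorGap` (stmt-QuantumFields-11141), line `registered` — the LINE DERIVATIVE of GREP's peeled
# expectation is the heat operator (step (G2) of the assembly of GREP, part 2: one derivative)

For GREP (`stub_gaussianBBFPolymerRep`): along the pair coordinate `ℓ = {p, q}` (`p ≠ q` atoms of `X`)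
the family `σ ↦ cov X σ` is LINEAR, `cov X (σ + t e_ℓ) = cov X σ + t B_ℓ` with
`(B_ℓ)_{ij} = 𝟙[blk i ≠ blk j, {blk i, blk j} = ℓ] C_{ij}`, so ✓HEAT (`stub_gaussianCovHeat`, p174060)
gives the derivative of `t ↦ E(cov X (σ + t e_ℓ))(H)` at `t = 0` for every `H` of the smooth
polynomial-growth class (hypotheses packaged by `PolyGrowth.exists_common_bound`,
`PolyGrowth.hasDerivAt_update_of_contDiff`), and since `σ ↦ E(cov X σ)(H)` is differentiable on the
open positive definite locus (✓`FullPt.exists_open_smooth_domain`) this derivative IS the Fréchet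
derivative applied to `e_ℓ`:
`fderiv (σ ↦ E(cov X σ)(H)) σ e_ℓ = ½ Σ_{a,b} (B_ℓ)_{ab} E(cov X σ)(∂_b ∂_a H)`
(`fderiv_gaussExpect_cov_single`).  The identification of the right side with GREP's `Dop ℓ H`
(`∂_b∂_a H = D²H(e_b, e_a)`, ✓`PolyGrowth.fderiv_partial_apply`) and the iteration along a script's
lines are the remaining bookkeeping of (G2) (LOCATE-GREP, evidence on stmt-QuantumFields-11141).
[folklore]; no definition, no named fact.
-/

set_option autoImplicit false

namespace Summit.QuantumFields.YangMills.Theorems.AnchorGap.LineDeriv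

open Finset MeasureTheory
open scoped Matrix Topology

variable {ι β : Type} [Fintype ι] [DecidableEq ι] [Fintype β] [DecidableEq β]

omit [Fintype ι] [DecidableEq ι] [Fintype β] in
/-- **The pair-interpolated covariance is linear along a pair coordinate**:
`cov X (σ + t e_ℓ) = cov X σ + t B_ℓ`. [folklore] -/
theorem cov_add_single (blk : ι → β) (C : Matrix ι ι ℝ) (X : Finset β) (σ : Sym2 β → ℝ)
    (ℓ : Sym2 β) (t : ℝ) :
    (Matrix.of fun i j : ι => (if blk i = blk j then 1 else if blk i ∈ X ∧ blk j ∈ X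
        then (σ + t • (Pi.single ℓ (1 : ℝ) : Sym2 β → ℝ)) s(blk i, blk j) else 0) * C i j)
      = (Matrix.of fun i j : ι => (if blk i = blk j then 1 else if blk i ∈ X ∧ blk j ∈ X
          then σ s(blk i, blk j) else 0) * C i j)
        + t • Matrix.of fun i j : ι => (if blk i = blk j then 0 else if blk i ∈ X ∧ blk j ∈ X
          then (if s(blk i, blk j) = ℓ then (1 : ℝ) else 0) else 0) * C i j := by
  ext i j
  simp only [Matrix.add_apply, Matrix.smul_apply, Matrix.of_apply, Pi.add_apply, Pi.smul_apply,
    smul_eq_mul]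
  by_cases h1 : blk i = blk j
  · simp [h1]
  · by_cases h2 : blk i ∈ X ∧ blk j ∈ X
    · simp only [if_neg h1, if_pos h2]
      by_cases h3 : s(blk i, blk j) = ℓ
      · rw [h3, Pi.single_eq_same, if_pos rfl]; ring
      · rw [Pi.single_eq_of_ne h3, if_neg h3]; ring
    · simp [h1, h2]

omit [Fintype ι] [DecidableEq ι] [Fintype β] in
/-- The direction matrix `B_ℓ` is symmetric (for `C` Hermitian). [folklore] -/
theorem isSymm_dirMatrix (blk : ι → β) {C : Matrix ι ι ℝ} (hC : C.IsHermitian) (X : Finset β)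
    (ℓ : Sym2 β) :
    (Matrix.of fun i j : ι => (if blk i = blk j then 0 else if blk i ∈ X ∧ blk j ∈ X
      then (if s(blk i, blk j) = ℓ then (1 : ℝ) else 0) else 0) * C i j).IsSymm := by
  have hCs : ∀ i j, C j i = C i j := fun i j => by simpa using (hC.apply j i).symm
  ext i j
  simp only [Matrix.transpose_apply, Matrix.of_apply]
  rw [hCs i j, Sym2.eq_swap]
  by_cases h1 : blk i = blk j
  · rw [if_pos h1, if_pos h1.symm]
  · rw [if_neg h1, if_neg (Ne.symm h1)]
    simp only [and_comm]

/-- **The line derivative of the peeled expectation (one derivative).** For `C` positive definite,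
atoms `blk`, an atom set `X`, `H` of the smooth polynomial-growth class and `σ` with `cov X σ`
positive definite:
`fderiv (σ ↦ E(cov X σ)(H)) σ e_ℓ = ½ Σ_{a,b} (B_ℓ)_{ab} · E(cov X σ)(∂_b ∂_a H)`
(HEAT along the linear family `cov X σ + t B_ℓ`; `∂_a H = DH·e_a`, `∂_b∂_a H = D(∂_a H)·e_b`). [folklore] -/
theorem fderiv_gaussExpect_cov_single (blk : ι → β) (C : Matrix ι ι ℝ) (hC : C.PosDef) (X : Finset β)
    {H : (ι → ℝ) → ℝ} (hH : ContDiff ℝ (⊤ : ℕ∞) H)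
    (hb : ∀ n : ℕ, ∃ (K : ℝ) (m : ℕ), ∀ φ : ι → ℝ, ‖iteratedFDeriv ℝ n H φ‖ ≤ K * (1 + ∑ i, φ i ^ 2) ^ m)
    {σ : Sym2 β → ℝ}
    (hσ : (Matrix.of fun i j : ι => (if blk i = blk j then 1 else if blk i ∈ X ∧ blk j ∈ X
      then σ s(blk i, blk j) else 0) * C i j).PosDef) (ℓ : Sym2 β) :
    fderiv ℝ (fun σ : Sym2 β → ℝ =>
        (∫ φ : ι → ℝ, H φ * Real.exp (-(φ ⬝ᵥ ((Matrix.of fun i j : ι =>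
            (if blk i = blk j then 1 else if blk i ∈ X ∧ blk j ∈ X then σ s(blk i, blk j) else 0)
              * C i j)⁻¹ *ᵥ φ)) / 2))
        / ∫ φ : ι → ℝ, Real.exp (-(φ ⬝ᵥ ((Matrix.of fun i j : ι =>
            (if blk i = blk j then 1 else if blk i ∈ X ∧ blk j ∈ X then σ s(blk i, blk j) else 0)
              * C i j)⁻¹ *ᵥ φ)) / 2)) σ (Pi.single ℓ 1)
      = (1 / 2) * ∑ a : ι, ∑ b : ι,
          ((if blk a = blk b then 0 else if blk a ∈ X ∧ blk b ∈ X
            then (if s(blk a, blk b) = ℓ then (1 : ℝ) else 0) else 0) * C a b) *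
          ((∫ φ : ι → ℝ, fderiv ℝ (fun φ : ι → ℝ => fderiv ℝ H φ (Pi.single a 1)) φ (Pi.single b 1)
              * Real.exp (-(φ ⬝ᵥ ((Matrix.of fun i j : ι =>
                (if blk i = blk j then 1 else if blk i ∈ X ∧ blk j ∈ X then σ s(blk i, blk j) else 0)
                  * C i j)⁻¹ *ᵥ φ)) / 2))
            / ∫ φ : ι → ℝ, Real.exp (-(φ ⬝ᵥ ((Matrix.of fun i j : ι =>
                (if blk i = blk j then 1 else if blk i ∈ X ∧ blk j ∈ X then σ s(blk i, blk j) else 0)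
                  * C i j)⁻¹ *ᵥ φ)) / 2)) := by
  -- names
  set cv : (Sym2 β → ℝ) → Matrix ι ι ℝ := fun σ => Matrix.of fun i j : ι =>
    (if blk i = blk j then 1 else if blk i ∈ X ∧ blk j ∈ X then σ s(blk i, blk j) else 0) * C i j
    with hcv
  set B : Matrix ι ι ℝ := Matrix.of fun i j : ι => (if blk i = blk j then 0 else if blk i ∈ X ∧ blk j ∈ X
    then (if s(blk i, blk j) = ℓ then (1 : ℝ) else 0) else 0) * C i j with hB
  set Ef : Matrix ι ι ℝ → ((ι → ℝ) → ℝ) → ℝ := fun M F =>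
    (∫ φ : ι → ℝ, F φ * Real.exp (-(φ ⬝ᵥ (M⁻¹ *ᵥ φ)) / 2))
      / ∫ φ : ι → ℝ, Real.exp (-(φ ⬝ᵥ (M⁻¹ *ᵥ φ)) / 2) with hEf
  show fderiv ℝ (fun σ => Ef (cv σ) H) σ (Pi.single ℓ 1)
    = (1 / 2) * ∑ a : ι, ∑ b : ι, B a b *
        Ef (cv σ) (fun φ => fderiv ℝ (fun φ : ι → ℝ => fderiv ℝ H φ (Pi.single a 1)) φ (Pi.single b 1))
  -- (1) HEAT along the linear family `cv σ + t B`
  have hlin : ∀ t : ℝ, cv (σ + t • (Pi.single ℓ (1 : ℝ) : Sym2 β → ℝ)) = cv σ + t • B := fun t =>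
    cov_add_single blk C X σ ℓ t
  have hpd0 : (cv σ + (0 : ℝ) • B).PosDef := by rw [zero_smul, add_zero]; exact hσ
  obtain ⟨K, m, hb0, hb1, hb2⟩ := PolyGrowth.exists_common_bound hH hb
  have hheat := stub_gaussianCovHeat ι (cv σ) B 0 hpd0 (isSymm_dirMatrix blk hC.isHermitian X ℓ) m K H
    (fun a φ => fderiv ℝ H φ (Pi.single a 1))
    (fun a b φ => fderiv ℝ (fun φ : ι → ℝ => fderiv ℝ H φ (Pi.single a 1)) φ (Pi.single b 1))
    hH.continuous.aestronglyMeasurable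
    (fun a => (PolyGrowth.contDiff_partial hH _).continuous.aestronglyMeasurable)
    (fun a b => (PolyGrowth.contDiff_partial (PolyGrowth.contDiff_partial hH _) _).continuous.aestronglyMeasurable)
    hb0 hb1 hb2
    (fun a φ => PolyGrowth.hasDerivAt_update_of_contDiff hH a φ)
    (fun a b φ => PolyGrowth.hasDerivAt_update_of_contDiff (PolyGrowth.contDiff_partial hH _) b φ)
  rw [zero_smul, add_zero] at hheat
  -- (2) the same curve through the Fréchet derivative: `σ ↦ E(cv σ)(H)` is smooth on the open PD locus
  have hcd : ContDiff ℝ (⊤ : ℕ∞) (fun σ : Sym2 β → ℝ => fun i j : ι => cv σ i j) := by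
    refine contDiff_pi.2 fun i => contDiff_pi.2 fun j => ?_
    by_cases h1 : blk i = blk j
    · simp only [hcv, Matrix.of_apply, if_pos h1]; exact contDiff_const
    · by_cases h2 : blk i ∈ X ∧ blk j ∈ X
      · simp only [hcv, Matrix.of_apply, if_neg h1, if_pos h2]
        exact (contDiff_apply ℝ ℝ (s(blk i, blk j))).mul contDiff_const
      · simp only [hcv, Matrix.of_apply, if_neg h1, if_neg h2]; exact contDiff_const
  have hsy : ∀ σ' : Sym2 β → ℝ, (Matrix.of (fun i j : ι => cv σ' i j)).IsSymm := by
    intro σ'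
    have hCs : ∀ i j, C j i = C i j := fun i j => by simpa using (hC.isHermitian.apply j i).symm
    ext i j
    simp only [Matrix.transpose_apply, Matrix.of_apply, hcv]
    rw [hCs i j, Sym2.eq_swap]
    by_cases h1 : blk i = blk j
    · rw [if_pos h1, if_pos h1.symm]
    · rw [if_neg h1, if_neg (Ne.symm h1)]
      simp only [and_comm]
  have hUo : IsOpen {σ' : Sym2 β → ℝ | (Matrix.of (fun i j : ι => cv σ' i j)).PosDef} :=
    GaussSmooth.isOpen_posDef_preimage hcd.continuous hsy
  have hfU : ContDiffOn ℝ (⊤ : ℕ∞) (fun σ' : Sym2 β → ℝ => Ef (cv σ') H)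
      {σ' : Sym2 β → ℝ | (Matrix.of (fun i j : ι => cv σ' i j)).PosDef} :=
    (GaussSmooth.contDiffOn_gaussExpect_cov H K m hH.continuous.measurable hb0).comp hcd.contDiffOn
      fun σ' hσ' => hσ'
  have hσU : σ ∈ {σ' : Sym2 β → ℝ | (Matrix.of (fun i j : ι => cv σ' i j)).PosDef} := hσ
  have hdiff : DifferentiableAt ℝ (fun σ' : Sym2 β → ℝ => Ef (cv σ') H) σ :=
    (hfU.differentiableOn (by simp)).differentiableAt (hUo.mem_nhds hσU)
  -- the curve `t ↦ σ + t e_ℓ`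
  have hγ : HasDerivAt (fun t : ℝ => σ + t • (Pi.single ℓ (1 : ℝ) : Sym2 β → ℝ))
      (Pi.single ℓ (1 : ℝ) : Sym2 β → ℝ) 0 := by
    have h := ((hasDerivAt_id (0 : ℝ)).smul_const (Pi.single ℓ (1 : ℝ) : Sym2 β → ℝ)).const_add σ
    simpa using h
  have hpt : σ + (0 : ℝ) • (Pi.single ℓ (1 : ℝ) : Sym2 β → ℝ) = σ := by simp
  have hdiff' : HasFDerivAt (fun σ' : Sym2 β → ℝ => Ef (cv σ') H)
      (fderiv ℝ (fun σ' : Sym2 β → ℝ => Ef (cv σ') H) σ) (σ + (0 : ℝ) • (Pi.single ℓ (1 : ℝ) : Sym2 β → ℝ)) := by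
    rw [hpt]; exact hdiff.hasFDerivAt
  have hcomp := hdiff'.comp_hasDerivAt (0 : ℝ) hγ
  simp only [Function.comp_def, hlin] at hcomp
  exact hcomp.unique hheat

end Summit.QuantumFields.YangMills.Theorems.AnchorGap.LineDeriv
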